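import Summits.AtomisticToContinuum.FouriersLaw.Theorems.BondHeatUncertaintyLightConeBondHeatVirialAlgebra
import Literature.MathematicalPhysics.KineticTheory.LangevinChainNESSProofs

/-!
# `NonBallistic` / light cone, assembly part 2a: local Lipschitz bound of the bond current

Helper (`--supports stmt-AtomisticToContinuum-9127`) for stub `stub_lightConeWindow` (LC) of line `contact-current-forgetting`,
pathwise ingredient of the flip-insensitivity assembly: on states whose two bond positions lie in `[-R, R]` (`R ≥ 1`) the bond
current `j_k = -½(p_k + p_{k+1})V′(q_{k+1} − q_k)` of the pinned chain (`V′(r) = r + βr³`) is Lipschitz in the four bond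
coordinates with constant `7(1+β)R³(1 + |p_k| + |p_{k+1}|)`:

  `|j_k(z′) − j_k(z)| ≤ 7(1+β)R³(1 + |p_k| + |p_{k+1}|)(|δq_k| + |δp_k| + |δq_{k+1}| + |δp_{k+1}|)`

(`|V′(r)| ≤ 10(1+β)R³` and `|V′(r′) − V′(r)| ≤ 13(1+β)R²|r′ − r|` for `|r|, |r′| ≤ 2R`). Pure algebra; no measure theory.
-/

noncomputable section

namespace Summit.AtomisticToContinuum.FouriersLaw.Theorems.NonBallistic

open Literature.MathematicalPhysics.KineticTheory.HeatConduction
open Summit.AtomisticToContinuum.FouriersLaw.Theorems.LightConeBondHeat (bondCurrent_eq_of_lt)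

namespace FSAssembly

/-- `|V′(r)| = |r + βr³| ≤ 10(1+β)R³` for `|r| ≤ 2R`, `R ≥ 1`, `β ≥ 0`. -/
theorem abs_derivV_le {β R r : ℝ} (hβ : 0 ≤ β) (hR : 1 ≤ R) (hr : |r| ≤ 2 * R) :
    |r + β * r ^ 3| ≤ 10 * (1 + β) * R ^ 3 := by
  have hR0 : 0 ≤ R := le_trans zero_le_one hR
  have h3 : |r| ^ 3 ≤ (2 * R) ^ 3 := pow_le_pow_left₀ (abs_nonneg _) hr 3
  have hR3 : R ≤ R ^ 3 := by
    have h1 : R * 1 * 1 ≤ R * R * R := by gcongr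
    calc R = R * 1 * 1 := by ring
      _ ≤ R * R * R := h1
      _ = R ^ 3 := by ring
  calc |r + β * r ^ 3| ≤ |r| + |β * r ^ 3| := abs_add_le _ _
    _ = |r| + β * |r| ^ 3 := by rw [abs_mul, abs_of_nonneg hβ, abs_pow]
    _ ≤ 2 * R + β * (2 * R) ^ 3 := by gcongr
    _ = 2 * R + 8 * β * R ^ 3 := by ring
    _ ≤ 10 * (1 + β) * R ^ 3 := by nlinarith

/-- `|V′(r′) − V′(r)| ≤ 13(1+β)R²|r′ − r|` for `|r|, |r′| ≤ 2R`, `R ≥ 1`, `β ≥ 0`. -/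
theorem abs_derivV_sub_le {β R r r' : ℝ} (hβ : 0 ≤ β) (hR : 1 ≤ R) (hr : |r| ≤ 2 * R) (hr' : |r'| ≤ 2 * R) :
    |(r' + β * r' ^ 3) - (r + β * r ^ 3)| ≤ 13 * (1 + β) * R ^ 2 * |r' - r| := by
  have hR0 : 0 ≤ R := le_trans zero_le_one hR
  have hfac : (r' + β * r' ^ 3) - (r + β * r ^ 3) = (r' - r) * (1 + β * (r' ^ 2 + r' * r + r ^ 2)) := by ring
  rw [hfac, abs_mul, mul_comm]
  refine mul_le_mul_of_nonneg_right ?_ (abs_nonneg _)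
  have h1 : |r' ^ 2 + r' * r + r ^ 2| ≤ 12 * R ^ 2 := by
    have ha : r' ^ 2 ≤ (2 * R) ^ 2 := by
      calc r' ^ 2 = |r'| ^ 2 := (sq_abs _).symm
        _ ≤ (2 * R) ^ 2 := pow_le_pow_left₀ (abs_nonneg _) hr' 2
    have hb : r ^ 2 ≤ (2 * R) ^ 2 := by
      calc r ^ 2 = |r| ^ 2 := (sq_abs _).symm
        _ ≤ (2 * R) ^ 2 := pow_le_pow_left₀ (abs_nonneg _) hr 2
    have hc : |r' * r| ≤ (2 * R) * (2 * R) := by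
      rw [abs_mul]; exact mul_le_mul hr' hr (abs_nonneg _) (by positivity)
    calc |r' ^ 2 + r' * r + r ^ 2| ≤ |r' ^ 2 + r' * r| + |r ^ 2| := abs_add_le _ _
      _ ≤ |r' ^ 2| + |r' * r| + |r ^ 2| := by linarith [abs_add_le (r' ^ 2) (r' * r)]
      _ = r' ^ 2 + |r' * r| + r ^ 2 := by rw [abs_of_nonneg (sq_nonneg r'), abs_of_nonneg (sq_nonneg r)]
      _ ≤ (2 * R) ^ 2 + (2 * R) * (2 * R) + (2 * R) ^ 2 := by linarith
      _ = 12 * R ^ 2 := by ring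
  calc |1 + β * (r' ^ 2 + r' * r + r ^ 2)| ≤ |(1 : ℝ)| + |β * (r' ^ 2 + r' * r + r ^ 2)| := abs_add_le _ _
    _ = 1 + β * |r' ^ 2 + r' * r + r ^ 2| := by rw [abs_one, abs_mul, abs_of_nonneg hβ]
    _ ≤ 1 + β * (12 * R ^ 2) := by gcongr
    _ ≤ 13 * (1 + β) * R ^ 2 := by nlinarith

/-- **Local Lipschitz bound of the bond current of the pinned chain.** On a genuine bond `(k, k+1)`, for two states whose
bond positions are bounded by `R ≥ 1`:
`|j_k(z′) − j_k(z)| ≤ 7(1+β)R³(1 + |p_k| + |p_{k+1}|)(|δq_k| + |δp_k| + |δq_{k+1}| + |δp_{k+1}|)`. -/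
theorem abs_bondCurrent_sub_le {ω₂ lam β γ : ℝ} (hβ : 0 ≤ β) {N : ℕ} (k : Fin N) (hk : k.val + 1 < N)
    {R : ℝ} (hR : 1 ≤ R) (z z' : PhaseSpace N)
    (hq : |z.1 k| ≤ R) (hq1 : |z.1 ⟨k.val + 1, hk⟩| ≤ R) (hq' : |z'.1 k| ≤ R) (hq1' : |z'.1 ⟨k.val + 1, hk⟩| ≤ R) :
    |(pinnedChain ω₂ lam β γ).bondCurrent N k z' - (pinnedChain ω₂ lam β γ).bondCurrent N k z| ≤
      7 * (1 + β) * R ^ 3 * (1 + |z.2 k| + |z.2 ⟨k.val + 1, hk⟩|) *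
        (|z'.1 k - z.1 k| + |z'.2 k - z.2 k| + |z'.1 ⟨k.val + 1, hk⟩ - z.1 ⟨k.val + 1, hk⟩| +
          |z'.2 ⟨k.val + 1, hk⟩ - z.2 ⟨k.val + 1, hk⟩|) := by
  set k1 : Fin N := ⟨k.val + 1, hk⟩ with hk1
  have hR0 : 0 ≤ R := le_trans zero_le_one hR
  -- closed forms
  rw [bondCurrent_eq_of_lt (pinnedChain ω₂ lam β γ) hk z', bondCurrent_eq_of_lt (pinnedChain ω₂ lam β γ) hk z,
    pinnedChain_deriv_V, pinnedChain_deriv_V]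
  set r := z.1 k1 - z.1 k with hr
  set r' := z'.1 k1 - z'.1 k with hr'
  set a := z.2 k + z.2 k1 with ha
  set a' := z'.2 k + z'.2 k1 with ha'
  -- position data
  have hrb : |r| ≤ 2 * R := by
    calc |r| ≤ |z.1 k1| + |z.1 k| := abs_sub _ _
      _ ≤ R + R := add_le_add hq1 hq
      _ = 2 * R := by ring
  have hrb' : |r'| ≤ 2 * R := by
    calc |r'| ≤ |z'.1 k1| + |z'.1 k| := abs_sub _ _
      _ ≤ R + R := add_le_add hq1' hq'
      _ = 2 * R := by ring
  have hdr : |r' - r| ≤ |z'.1 k - z.1 k| + |z'.1 k1 - z.1 k1| := by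
    have : r' - r = (z'.1 k1 - z.1 k1) - (z'.1 k - z.1 k) := by rw [hr, hr']; ring
    rw [this]
    calc |(z'.1 k1 - z.1 k1) - (z'.1 k - z.1 k)| ≤ |z'.1 k1 - z.1 k1| + |z'.1 k - z.1 k| := abs_sub _ _
      _ = _ := by ring
  have hda : |a' - a| ≤ |z'.2 k - z.2 k| + |z'.2 k1 - z.2 k1| := by
    have : a' - a = (z'.2 k - z.2 k) + (z'.2 k1 - z.2 k1) := by rw [ha, ha']; ring
    rw [this]; exact abs_add_le _ _
  have haa : |a| ≤ |z.2 k| + |z.2 k1| := abs_add_le _ _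
  -- the two V′ bounds
  have hV' := abs_derivV_le hβ hR hrb'
  have hdV := abs_derivV_sub_le hβ hR hrb hrb'
  -- algebra: j' - j = -½ [ (a' - a) V′(r') + a (V′(r') - V′(r)) ]
  have hsplit : -(a' / 2 * (r' + β * r' ^ 3)) - -(a / 2 * (r + β * r ^ 3)) =
      -(1 / 2) * ((a' - a) * (r' + β * r' ^ 3) + a * ((r' + β * r' ^ 3) - (r + β * r ^ 3))) := by ring
  rw [hsplit, abs_mul, show |-(1 / 2 : ℝ)| = 1 / 2 by norm_num]
  have hT1 : |(a' - a) * (r' + β * r' ^ 3)| ≤ (|z'.2 k - z.2 k| + |z'.2 k1 - z.2 k1|) * (10 * (1 + β) * R ^ 3) := by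
    rw [abs_mul]; exact mul_le_mul hda hV' (abs_nonneg _) (by positivity)
  have hT2 : |a * ((r' + β * r' ^ 3) - (r + β * r ^ 3))| ≤
      (|z.2 k| + |z.2 k1|) * (13 * (1 + β) * R ^ 2 * (|z'.1 k - z.1 k| + |z'.1 k1 - z.1 k1|)) := by
    rw [abs_mul]
    refine mul_le_mul haa (hdV.trans ?_) (abs_nonneg _) (by positivity)
    exact mul_le_mul_of_nonneg_left hdr (by positivity)
  have hsum := abs_add_le ((a' - a) * (r' + β * r' ^ 3)) (a * ((r' + β * r' ^ 3) - (r + β * r ^ 3)))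
  -- collect: everything is ≤ 7(1+β)R³(1+|p_k|+|p_{k+1}|)·(sum of the four |δ|)
  have hR2 : R ^ 2 ≤ R ^ 3 := by
    have h1 : R ^ 2 * 1 ≤ R ^ 2 * R := by gcongr
    calc R ^ 2 = R ^ 2 * 1 := by ring
      _ ≤ R ^ 2 * R := h1
      _ = R ^ 3 := by ring
  have h0 : 0 ≤ |z'.2 k - z.2 k| + |z'.2 k1 - z.2 k1| := by positivity
  have h0' : 0 ≤ |z'.1 k - z.1 k| + |z'.1 k1 - z.1 k1| := by positivity
  have hp0 : 0 ≤ |z.2 k| + |z.2 k1| := by positivity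
  have hβ1 : 0 ≤ 1 + β := by linarith
  nlinarith [hT1, hT2, hsum, mul_nonneg hβ1 (pow_nonneg hR0 3), mul_nonneg (mul_nonneg hβ1 (pow_nonneg hR0 3)) hp0,
    mul_nonneg (mul_nonneg hβ1 (pow_nonneg hR0 3)) h0, mul_nonneg (mul_nonneg hβ1 (pow_nonneg hR0 3)) h0',
    mul_nonneg (mul_nonneg (mul_nonneg hβ1 (pow_nonneg hR0 2)) hp0) h0',
    mul_nonneg (mul_nonneg (mul_nonneg hβ1 (sub_nonneg.2 hR2)) hp0) h0',
    abs_nonneg ((a' - a) * (r' + β * r' ^ 3) + a * ((r' + β * r' ^ 3) - (r + β * r ^ 3)))]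

end FSAssembly

end Summit.AtomisticToContinuum.FouriersLaw.Theorems.NonBallistic

end
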